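import Summits.PneNP.PneNP.Theorems.SfmBlMachineGlue
import Summits.PneNP.PneNP.Theorems.SfmBlMachineHatSum
import Summits.PneNP.PneNP.Theorems.SfmBlMachineTraceSem
import Summits.PneNP.PneNP.Theorems.SfmBlMachineDictSparse
import Summits.PneNP.PneNP.Theorems.SfmBlCylinderHat
import Summits.PneNP.PneNP.Theorems.SfmBlExistsAux

/-!
# Line «sfm-bl», MACHINE LAYER M5 (closer, part 1): the machine's potential IS the pipeline's cylinder sum (stmt-PneNP-20523)

FRONTIER F-N1c; nothing here bears on P vs NP.

For a pure-`CAND` instance `I` (with `N = #pieces ≥ 1`), the extraction state `st = sfmExtract (trips I)` of the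
machine and prover-1's dictionary (`srcM`, `dstM`, `pM st.1 st.2 hlab`, `V₁M`, `V₂M` at `L = L0 = 2^60`):
* `card_sides_le_prmT0` — every spot has `|V₁ s| + |V₂ s| ≤ t₀` (spot history `SpotInv` + the size filter of `cands`);
* **`traceSum_sfm_eq`** — `(traceSum kk T0 2^(m−kk+1) (sfmRlegs) (sfmCapA) (sfmUA) : ℝ)
   = Σ_{T ∈ cyl(kk,T0)} tr((fromBlocks 0 (MR T) (MR T)ᵀ 0)^(2·(q+1)))` (M3-SEM `traceSum_eq_sum_cylinder` with the cap
   `3m·(40N)^240` discharged by `length_aseqsU_sub_le` + `params_bounds`);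
* **`hatSum_sfm_eq`** — `(hatSum G0 kk T0 m (sfmRecs) : ℝ) = Σ_{T ∈ cyl(kk,T0)} Σ_s Σ_{W ∈ bad s T} meet_s(W)` for the
  families `𝒲 s := ((V₁ s).powerset ×ˢ (V₂ s).powerset).filter IsConnectedPair`, `bad s T :=` the real test
  (M4-SEM `sum_spotRecs_eq` per spot + p3's `sum_cylinder_hat_eq`, caps `40N` / `(40N)^121` discharged).
The per-step comparison and the closer are part 2 (`SfmBlSigningFP`).
-/

set_option linter.dupNamespace false -- `Summit.PneNP.PneNP.…`: summit = sub-problem name (D-0017 single-conjunct layout)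

namespace Summit.PneNP.PneNP.Theorems.SfmBlMachine

open Finset Matrix Literature.Computability.Complexity
open Summit.PneNP.PneNP.Theorems.Nc03AvoidResidualCoreCandFewHeadsRungFP (trips)
open Summit.PneNP.PneNP.Theorems.CandCutNorm (boolSign)
open Summit.PneNP.PneNP.Theorems.SfmBl (IsConnectedPair sum_cylinder_hat_eq sum_part_eq₂ card_part_eq)

variable {n m : ℕ}

/-! ## The extraction state of the machine -/

/-- `L0` is positive. -/
theorem L0_pos : 0 < L0 := by unfold L0; positivity

/-- The extraction invariant for the machine's state: one label per leg, labels `≤ r ≤ 3m + 1`. -/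
theorem sfmExtract_inv (I : LocalMap 3 n m) :
    (sfmExtract (trips I)).1.length = 3 * m ∧ (∀ lab ∈ (sfmExtract (trips I)).1, lab ≤ (sfmExtract (trips I)).2) ∧
      (sfmExtract (trips I)).2 ≤ (sfmPlegs (trips I)).length + 1 := by
  have h := extractInv_extract γsq0 (sfmPlegs (trips I)) (sfmCands (trips I)) (List.replicate ((sfmPlegs (trips I)).length + 1) ())
  change ExtractInv (sfmPlegs (trips I)) (List.replicate ((sfmPlegs (trips I)).length + 1) ()).length
    (sfmExtract (trips I)) at h
  obtain ⟨h1, h2, h3⟩ := h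
  rw [List.length_replicate] at h3
  refine ⟨?_, h2, h3⟩
  rw [h1]; unfold sfmPlegs; rw [length_pieceLegs, length_trips]

/-- The clamp on the number of spots is inactive. -/
theorem sfmR'_eq (I : LocalMap 3 n m) : sfmR' (trips I) = (sfmExtract (trips I)).2 :=
  min_eq_left (sfmExtract_inv I).2.2

/-- **Every spot has `|V₁ s| + |V₂ s| ≤ t₀'`** (it was extracted from a candidate pair of total size `≤ t₀'`, inside
which all its legs run). -/
theorem card_sides_le_prmT0' (I : LocalMap 3 n m)
    (hlab : ∀ lab ∈ (sfmExtract (trips I)).1, lab ≤ (sfmExtract (trips I)).2) (s : Fin (sfmExtract (trips I)).2) :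
    (V₁M L0 I (sfmExtract (trips I)).1 (sfmExtract (trips I)).2 hlab s).card
      + (V₂M L0 I (sfmExtract (trips I)).1 (sfmExtract (trips I)).2 hlab s).card ≤ prmT0' (sfmN (trips I)) := by
  have hS := spotInv_extract γsq0 (sfmPlegs (trips I)) (sfmCands (trips I))
    (List.replicate ((sfmPlegs (trips I)).length + 1) ())
  obtain ⟨W, hW, hgeo, _⟩ := hS s.val s.isLt
  obtain ⟨h1, h2⟩ := card_V₁M_le_of_spotInv L0 I _ _ hlab (sfmExtract_inv I).1 s W hgeo
  have hsize : W.1.length + W.2.length ≤ prmT0' (sfmN (trips I)) := by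
    unfold sfmCands cands at hW
    rw [List.mem_filter, decide_eq_true_eq] at hW
    exact hW.2
  omega

/-! ## The closer's objects (part matrices, families, bad pairs, meeting counts) -/

section Objs

variable (I : LocalMap 3 n m) (st : List ℕ × ℕ) (hlab : ∀ lab ∈ st.1, lab ≤ st.2)

/-- The part matrices `M_{p,T}`: `Σ_{e : src e = i, dst e = k, p e = c} χ(T e.1)`. -/
noncomputable def MpS (T : Fin m → Bool) (c : Option (Fin st.2)) : Matrix (LPiece L0 I) (RPiece L0 I) ℝ :=
  fun i k => ∑ e ∈ univ.filter (fun e : Fin m × Fin 3 => srcM L0 I e = i ∧ dstM L0 I e = k ∧ pM st.1 st.2 hlab e = c),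
    ((boolSign (T e.1) : ℤ) : ℝ)

open scoped Classical in
/-- The family `𝒲 s`: sub-pairs of the sides of spot `s`, connected through its legs. -/
noncomputable def WS (s : Fin st.2) : Finset (Finset (LPiece L0 I) × Finset (RPiece L0 I)) :=
  ((V₁M L0 I st.1 st.2 hlab s).powerset ×ˢ (V₂M L0 I st.1 st.2 hlab s).powerset).filter fun W =>
    IsConnectedPair (fun i k => ∃ e : {e // pM st.1 st.2 hlab e = some s}, srcM L0 I e.1 = i ∧ dstM L0 I e.1 = k) W.1 W.2

open scoped Classical in
/-- The bad pairs of spot `s` under the signing `T` (real threshold `γ' = √(6000·2^60)`). -/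
noncomputable def badS (s : Fin st.2) (T : Fin m → Bool) : Finset (Finset (LPiece L0 I) × Finset (RPiece L0 I)) :=
  (WS I st hlab s).filter fun W => Real.sqrt (6000 * 2 ^ 60) * Real.sqrt ((W.1.card : ℝ) * (W.2.card : ℝ))
    < |∑ i ∈ W.1, ∑ k ∈ W.2, MpS I st hlab T (some s) i k|

/-- `meet_s(W)`: the number of legs of spot `s` meeting the pair. -/
noncomputable def meetS (s : Fin st.2) (W : Finset (LPiece L0 I) × Finset (RPiece L0 I)) : ℝ :=
  ((univ.filter fun e : Fin m × Fin 3 => (srcM L0 I e ∈ W.1 ∨ dstM L0 I e ∈ W.2) ∧ pM st.1 st.2 hlab e = some s).card : ℝ)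

/-- Membership in `𝒲 s` (the shape of `h𝒲` of `cutCertified_of_pipeline`). -/
theorem mem_WS_iff (s : Fin st.2) (W : Finset (LPiece L0 I) × Finset (RPiece L0 I)) :
    W ∈ WS I st hlab s ↔ W.1 ⊆ V₁M L0 I st.1 st.2 hlab s ∧ W.2 ⊆ V₂M L0 I st.1 st.2 hlab s ∧
      IsConnectedPair (fun i k => ∃ e : {e // pM st.1 st.2 hlab e = some s}, srcM L0 I e.1 = i ∧ dstM L0 I e.1 = k)
        W.1 W.2 := by
  unfold WS
  simp only [mem_filter, mem_product, mem_powerset, and_assoc]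

/-- Membership in `bad s T` (the shape of `hbad`). -/
theorem mem_badS_iff (s : Fin st.2) (T : Fin m → Bool) (W : Finset (LPiece L0 I) × Finset (RPiece L0 I)) :
    W ∈ badS I st hlab s T ↔ W ∈ WS I st hlab s ∧
      Real.sqrt (6000 * 2 ^ 60) * Real.sqrt ((W.1.card : ℝ) * (W.2.card : ℝ))
        < |∑ i ∈ W.1, ∑ k ∈ W.2, MpS I st hlab T (some s) i k| := by
  unfold badS; simp only [mem_filter]

end Objs

/-! ## The trace part -/

/-- **M3-SEM for the machine's data.** -/
theorem traceSum_sfm_eq (I : LocalMap 3 n m) (hN1 : 1 ≤ sfmN (trips I)) (st : List ℕ × ℕ) (hst : sfmExtract (trips I) = st)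
    (hlab : ∀ lab ∈ st.1, lab ≤ st.2) {kk : ℕ} (hkk : kk ≤ m) (T0 : List Bool) :
    ((traceSum kk T0 (2 ^ (m - kk + 1)) (sfmRlegs (trips I)) (sfmCapA (trips I)) (sfmUA (trips I)) : ℤ) : ℝ)
      = ∑ T ∈ (univ : Finset (Fin m → Bool)).filter
            (fun T => ∀ i ∈ univ.filter (fun i : Fin m => (i : ℕ) < kk), T i = T0.getD i.val false),
          ((Matrix.fromBlocks 0 (MpS I st hlab T none) (MpS I st hlab T none)ᵀ 0) ^ (2 * prmQ1' (sfmN (trips I)))).trace := by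
  classical
  subst hst
  have hlen := (sfmExtract_inv I).1
  have hq1 := prmQ1'_eq hN1
  have hq : 2 * prmQ1' (sfmN (trips I)) = 2 * ((prmQ1' (sfmN (trips I)) - 1) + 1) := by
    have : 1 ≤ prmQ1' (sfmN (trips I)) := by rw [hq1]; exact Nat.one_le_two_pow
    omega
  rw [hq]
  refine traceSum_eq_sum_cylinder (src := srcM L0 I) (dst := dstM L0 I)
    (p := pM (sfmExtract (trips I)).1 (sfmExtract (trips I)).2 hlab) (ι₁ := Subtype.val) (ι₂ := Subtype.val)
    (φ := plegOf L0 I) (plegOf_injective L0 I) (nodup_rlegs (nodup_pieceLegs _ _) _)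
    (fun x => mem_rlegs_iff_pM L0 I hlab hlen x) (fun _ => rfl) (fun _ => rfl) (plegOf_fst L0 I)
    Subtype.val_injective Subtype.val_injective _ (fun _ _ _ => rfl) hkk T0 _ _ _ ?_ ?_
  · unfold sfmUA; rw [List.length_replicate]; omega
  · intro k' hk'
    unfold sfmUA at hk'; rw [List.length_replicate] at hk'
    obtain ⟨hQ, _, hLell, _⟩ := params_bounds hN1
    show (aseqsU (rlegs (pieceLegs L0 (trips I)) (sfmExtract (trips I)).1) k').length ≤ 3 * (trips I).length * (40 * sfmN (trips I)) ^ 240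
    refine (length_aseqsU_sub_le L0_pos (trips I) (rlegs_sublist _ _) k').trans (Nat.mul_le_mul_left _ ?_)
    calc L0 ^ k' ≤ L0 ^ (2 * 2 ^ prmJ1 (sfmN (trips I))) := Nat.pow_le_pow_right L0_pos (by rw [hq1] at hk'; omega)
      _ ≤ (40 * sfmN (trips I)) ^ 240 := hLell

/-! ## The hat part -/

/-- ONE SPOT: the machine's list sum over the records of spot `s` is the pipeline's cylinder sum of `ê_s`. -/
theorem spot_hat_eq (I : LocalMap 3 n m) (hN1 : 1 ≤ sfmN (trips I)) (st : List ℕ × ℕ) (hst : sfmExtract (trips I) = st)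
    (hlab : ∀ lab ∈ st.1, lab ≤ st.2) (kk : ℕ) (T0 : List Bool) (s : Fin st.2) :
    ((((spotRecs (sfmCapS (trips I)) (sfmCapW (trips I)) (slegs (sfmPlegs (trips I)) st.1 s.val)).map
        fun rec => rec.2.1 * badCount G0 kk T0 m rec).sum : ℕ) : ℝ)
      = ∑ T ∈ (univ : Finset (Fin m → Bool)).filter
            (fun T => ∀ i ∈ univ.filter (fun i : Fin m => (i : ℕ) < kk), T i = T0.getD i.val false),
          ∑ W ∈ badS I st hlab s T, meetS I st hlab s W := by
  classical
  subst hst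
  have hlen : (sfmExtract (trips I)).1.length = 3 * m := (sfmExtract_inv I).1
  obtain ⟨hQ, hT0, hLell, hL2t0, h2t0⟩ := params_bounds hN1
  have ht0' := prmT0'_eq hN1
  have hsides : (V₁M L0 I (sfmExtract (trips I)).1 (sfmExtract (trips I)).2 hlab s).card
      + (V₂M L0 I (sfmExtract (trips I)).1 (sfmExtract (trips I)).2 hlab s).card ≤ prmT0 (sfmN (trips I)) := by
    have := card_sides_le_prmT0' I hlab s; rwa [ht0'] at this
  have hV1 : (lpieces (slegs (sfmPlegs (trips I)) (sfmExtract (trips I)).1 s.val)).length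
      = (V₁M L0 I (sfmExtract (trips I)).1 (sfmExtract (trips I)).2 hlab s).card :=
    (card_V₁M_eq_length_lpieces L0 I hlab hlen s).symm
  have hV2 : (rpieces (slegs (sfmPlegs (trips I)) (sfmExtract (trips I)).1 s.val)).length
      = (V₂M L0 I (sfmExtract (trips I)).1 (sfmExtract (trips I)).2 hlab s).card :=
    (card_V₂M_eq_length_rpieces L0 I hlab hlen s).symm
  -- the generic M4-SEM identity for this spot
  have key := sum_spotRecs_eq (E := {e // pM (sfmExtract (trips I)).1 (sfmExtract (trips I)).2 hlab e = some s})
    (ι₁ := Subtype.val) (ι₂ := Subtype.val)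
    (srcE := fun e => srcM L0 I e.1) (dstE := fun e => dstM L0 I e.1) (φ := fun e => plegOf L0 I e.1)
    (xs := slegs (sfmPlegs (trips I)) (sfmExtract (trips I)).1 s.val) (m := m) (fun e => e.1.1) (fun e => plegOf_fst L0 I e.1)
    (fun a b h => Subtype.ext (plegOf_injective L0 I h)) (nodup_slegs _ _ _ _)
    (fun x => mem_slegs_iff_subtype L0 I hlab hlen s x) (fun _ => rfl) (fun _ => rfl)
    Subtype.val_injective Subtype.val_injective (fun a => LPiece.tag a) (fun b => RPiece.tag b)
    (capS := sfmCapS (trips I)) (capW := sfmCapW (trips I)) ?_ ?_ G0 kk T0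
  · have hV₁ : (univ.image fun e : {e // pM (sfmExtract (trips I)).1 (sfmExtract (trips I)).2 hlab e = some s} =>
        srcM L0 I e.1) = V₁M L0 I (sfmExtract (trips I)).1 (sfmExtract (trips I)).2 hlab s := by
      ext i; simp only [V₁M, mem_image, mem_filter, mem_univ, true_and]
      exact ⟨fun ⟨e, he⟩ => ⟨e.1, e.2, he⟩, fun ⟨e, he, hi⟩ => ⟨⟨e, he⟩, hi⟩⟩
    have hV₂ : (univ.image fun e : {e // pM (sfmExtract (trips I)).1 (sfmExtract (trips I)).2 hlab e = some s} =>
        dstM L0 I e.1) = V₂M L0 I (sfmExtract (trips I)).1 (sfmExtract (trips I)).2 hlab s := by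
      ext i; simp only [V₂M, mem_image, mem_filter, mem_univ, true_and]
      exact ⟨fun ⟨e, he⟩ => ⟨e.1, e.2, he⟩, fun ⟨e, he, hi⟩ => ⟨⟨e, he⟩, hi⟩⟩
    rw [key, hV₁, hV₂, Nat.cast_sum]
    -- the pipeline side through p3's `sum_cylinder_hat_eq`
    have hG : Real.sqrt (6000 * 2 ^ 60) = Real.sqrt ((G0 : ℕ) : ℝ) := by norm_num [G0]
    have hrhs := sum_cylinder_hat_eq (fun e : {e // pM (sfmExtract (trips I)).1 (sfmExtract (trips I)).2 hlab e = some s} =>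
        srcM L0 I e.1) (fun e => dstM L0 I e.1) (fun e => e.1.1) G0
      (fun T => MpS I (sfmExtract (trips I)) hlab T (some s))
      (fun T i k => by
        unfold MpS
        exact (sum_part_eq₂ (pM (sfmExtract (trips I)).1 (sfmExtract (trips I)).2 hlab) (some s)
          (fun e => srcM L0 I e = i) (fun e => dstM L0 I e = k) _).symm)
      (WS I (sfmExtract (trips I)) hlab s) (meetS I (sfmExtract (trips I)) hlab s)
      ((univ : Finset (Fin m → Bool)).filter
        (fun T => ∀ i ∈ univ.filter (fun i : Fin m => (i : ℕ) < kk), T i = T0.getD i.val false))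
    unfold badS
    rw [hG, hrhs]
    refine Finset.sum_congr rfl fun W _ => ?_
    rw [Nat.cast_mul]
    refine congrArg₂ (· * ·) ?_ (congrArg Nat.cast ?_)
    · unfold meetS
      rw [card_part_eq (pM (sfmExtract (trips I)).1 (sfmExtract (trips I)).2 hlab) (some s)
        (fun e => srcM L0 I e ∈ W.1 ∨ dstM L0 I e ∈ W.2)]
    · rw [Finset.filter_filter]
      exact congrArg Finset.card (Finset.filter_congr fun T _ => and_congr_right fun _ => by
        rw [Nat.cast_mul, Nat.cast_mul, mul_assoc])
  · -- the sublist cap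
    rw [hV1, hV2]
    unfold sfmCapS
    constructor
    · exact (Nat.pow_le_pow_right (by norm_num) (by omega)).trans h2t0
    · exact (Nat.pow_le_pow_right (by norm_num) (by omega)).trans h2t0
  · -- the walk cap
    intro W k' hk'
    rw [hV1, hV2] at hk'
    unfold sfmCapW
    have hsub : List.Sublist (legsIn (slegs (sfmPlegs (trips I)) (sfmExtract (trips I)).1 s.val) W)
        (pieceLegs L0 (trips I)) :=
      (List.filter_sublist).trans (sublist_slegs _ _ _)
    refine (length_walksU_sub_le L0_pos (trips I) hsub k').trans ?_
    change sfmN (trips I) * L0 ^ k' ≤ _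
    calc sfmN (trips I) * L0 ^ k' ≤ sfmN (trips I) * L0 ^ (2 * prmT0 (sfmN (trips I))) :=
          Nat.mul_le_mul_left _ (Nat.pow_le_pow_right L0_pos (by omega))
      _ ≤ (40 * sfmN (trips I)) * (40 * sfmN (trips I)) ^ 120 := Nat.mul_le_mul (by omega) hL2t0
      _ = (40 * sfmN (trips I)) ^ 121 := by ring

/-- **M4-SEM for the machine's data**: `hatSum = Σ_{T ∈ cyl} Σ_s Σ_{W ∈ bad s T} meet_s(W)`. -/
theorem hatSum_sfm_eq (I : LocalMap 3 n m) (hN1 : 1 ≤ sfmN (trips I)) (st : List ℕ × ℕ) (hst : sfmExtract (trips I) = st)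
    (hlab : ∀ lab ∈ st.1, lab ≤ st.2) (kk : ℕ) (T0 : List Bool) :
    ((hatSum G0 kk T0 m (sfmRecs (trips I)) : ℕ) : ℝ)
      = ∑ T ∈ (univ : Finset (Fin m → Bool)).filter
            (fun T => ∀ i ∈ univ.filter (fun i : Fin m => (i : ℕ) < kk), T i = T0.getD i.val false),
          ∑ s : Fin st.2, ∑ W ∈ badS I st hlab s T, meetS I st hlab s W := by
  rw [Finset.sum_comm]
  unfold sfmRecs
  rw [hatSum_allRecs_eq, sfmR'_eq, Nat.cast_sum, hst,
    ← Fin.sum_univ_eq_sum_range (fun s => (((spotRecs (sfmCapS (trips I)) (sfmCapW (trips I))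
      (slegs (sfmPlegs (trips I)) st.1 s)).map fun rec => rec.2.1 * badCount G0 kk T0 m rec).sum : ℝ))]
  exact Finset.sum_congr rfl fun s _ => spot_hat_eq I hN1 st hst hlab kk T0 s

end Summit.PneNP.PneNP.Theorems.SfmBlMachine
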